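import Summits.Ventures.CertifiedManyBodySolver.Observables.PhaseSeparationExclusionBox
import Summits.Ventures.CertifiedManyBodySolver.Observables.PhaseSeparationExclusionBoxZeemanTcap
import Summits.Ventures.CertifiedManyBodySolver.Observables.PhaseSeparationExclusionFarPlanesStrip
import Summits.Ventures.CertifiedManyBodySolver.Observables.PhaseSeparationExclusionHalfOneStrip
import Summits.Ventures.CertifiedManyBodySolver.Observables.PhaseSeparationExclusionNearStripElectronSideColumns
import Summits.Ventures.CertifiedManyBodySolver.Observables.PhaseSeparationExclusionNearStripElectronSideColumnsB
import Summits.Ventures.CertifiedManyBodySolver.Observables.PhaseSeparationExclusionQuarterConvexFloorB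
import Summits.Ventures.CertifiedManyBodySolver.Observables.PhaseSeparationExclusionQuarterLowUFloor
import Summits.Ventures.CertifiedManyBodySolver.Observables.PhaseSeparationExclusionStripPolCaps
import Summits.Ventures.CertifiedManyBodySolver.Observables.PhaseSeparationExclusionTPrimeStripEXT5
import Summits.Ventures.CertifiedManyBodySolver.Observables.PhaseSeparationExclusionWitnessSplitCap597
import HarnessLib
import HarnessLib.Audit

/-!
# Ventures/CertifiedManyBodySolver — Observables/PhaseSeparationExclusionNearStripCVDAxesHQF.lean: `(≤ 1/2 ∣ ≥ 1)` — no macroscopic coexistence of the half-filled-or-denser parent with a QUARTER-FILLED-or-emptier phase — on the cuprate strip: the `T = 0` FIELD axis (every `|h| ≤ h₀·t`) («THE #674 COLUMN», hubbard-downfold-unc-2 g36)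

LOW-U-QUARTER-FLOOR edition («THE LOW-U QUARTER FLOOR», generator flag `--lowU`): on cells with lower column `U₁ ∈ [4, 8)` the quarter-filling floor is the `t′`-chord between the `U`-chords #649 `(6,½,−3/10)` ⊕ #606 `(8,½,−3/10)` (free sea ⊕ #649 below `U = 6`) and #570 `(4,½,0) ≥ −1.1662314554` ⊕ #576 `(8,½,0)` — four registry rows BY NAME (`h649`/`h606`/`h570`/`h576`), no kinematic carry (`hw_half_floorLow68At` / `hw_half_floorLow46At`, `Observables/PhaseSeparationExclusionQuarterLowUFloor.lean`, this seat g36): `+0.026 ∣ +0.025 ∣ +0.024` over g34's free-chord floor at `U₀ = 6`, `s = −3/10 ∣ −1/4 ∣ −1/5` (`+0.019` at `13/2`, `+0.012` at `7`, `+0.006` at `15/2`); theorem names `cr…`/`ct…`. STRIP-POLARISED-CAP edition («THE 3/4-FILLING CAPS», generator flag `--pc`): the CAP menu of every cell additionally holds sr-mbsolver's PREMISE-FREE CONSTANT polarised-sea caps at fillings `7/10 ∣ 3/4 ∣ 17/20` on `t′ ∈ [−3/10,−1/5]` (`polS3n0700 = −0.7903676196`, `polS3n0750 = −0.7336528871`,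 `polS3n0850`; `polS4*`/`polS5*` on `[−1/5,−1/10]`/`[−1/10,0]`; `Observables/PhaseSeparationExclusionStripPolCaps.lean`, this seat g36, one-line instances of `Certificates/HubbardSquare_polarizedSeaCaps_cs3atlas{A,B}` [cite: BachLiebSolovej1994, eq. (2c.36)]) — at `U ≥ 12` they are the better word caps (witness filling `3/4` or `7/10` instead of `5/8`; the WS597 plane reads `−0.69∣−0.63` at `(12∣14, −3/10)`): exact `T = 0` margins `Q × [12,14]∣[14,16]∣[12,16]` `(≤1/2∣≥1)` `→ 0.0522∣0.0540∣0.0522`, `(≤9/20∣≥1)` `→ 0.0580∣0.0599∣0.0580`, `D × [12,16]` `→ 0.0666∣0.0759`; theorem names `cp…`/`cq…`. «THE #674 COLUMN» edition (hubbard-downfold-unc-2 g36, generator `gen-g36/yb/gen36.py` over the g31–g35 generators): identical to the g35 FILLING-CONVEXITY-FLOOR edition except that the `U = 10` QUARTER-FILLING column is the `t′`-chord of the NEW certified row #674 `(10,½,−3/10) ≥ −0.9178863326` (`Certificates/HubbardSquare_U10_n1o2_tpm3o10_lower_row674.lean`, hubbard-algo-eng-8 twin-chain, tree 2026-08-30T04:04Z)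 and #607 `(10,½,0) ≥ −1.0777526533` — `hw_half_col10b` = `−1.0778 − 0.5329·s` (`+0.0092 ∣ +0.0077 ∣ +0.0061` over g35's #606-carried `hw_half_col10` at `s = −3/10 ∣ −1/4 ∣ −1/5`), its `U`-chord with `hw_half_col8` on `[8,10]` (`hw_half_floor810bAt`) (`Observables/PhaseSeparationExclusionQuarterConvexFloorB.lean`, this seat g36); for `(≤ 1/2 ∣ ≥ 1)` that column IS the dilute floor (`hF₁` slot), carried to `U ≥ U₁` by Griffiths monotonicity. Registry rows #674/#607 (and #606/#576 on `[8,10]`) BY NAME. Dilute `T > 0` anchor = kernel free gas `β* = 3/2` at `n = 1/2` (g34 anchors). Theorem names `cx…_1o2_…` / `cy…_1o2_…`.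
HONEST FRAMING: first certified bounds; not a superconductivity verdict. CLASS = DERIVED / CONTEXT (competing-order words, CONTROL class: the excluded partner phase has
hole doping `≥ 1/2`). PURPOSE: the temperature / field / chemical-potential / interlayer ROBUSTNESS annex of the phase maps (D-0098) on the La-214 strip `t′ ∈ [−3/10,−1/5]`
(La₂₋ₓSrₓCuO₄ La214E ×10 `[−0.3,−0.2] × [5.9,14.7]` — its binding cells are the thin top cells `Q × [12,14] ∣ [14,16] ∣ [12,16]`, whose exact `T = 0` margins the new column
roughly doubles: `(≤1/2∣≥1)` `0.0036 ∣ 0.0045 ∣ 0.0036 → 0.0082 ∣ 0.0091 ∣ 0.0082`, `(≤9/20∣≥1)` `0.0080 ∣ 0.0057 ∣ 0.0080 → 0.0130 ∣ 0.0116 ∣ 0.0130`). Laws (this seat g22–g26/g32/g33):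
`psT_not_thermal_mix_on_cell_of_columns_hotAnchorSS_tcap` (canonical sector-Gibbs torus limits, every `β ≥ β₀`), `psHT_not_fieldEquilibrium_mix_on_cell_of_columns_hotAnchorSS_tcap` /
`psH_not_fieldGroundState_mix_on_cell_of_columns_tcap` (field), `psGCT_not_equilibrium_…` / `psGC_gap_on_cell_of_columns_tcap` (μ), `psL_not_layeredGroundState_mix_on_cell_of_columns_tcap`
(interlayer), `…doccAnchor_tcap` (Mott anchor); CAP per cell = the WS597 witness-split plane of the certified #597 state at filling `3/4` (`wsplit597_cap_tcap_on_cell`, claim node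
`cert_plaqseam_W4split597_TBD_allmk` BY NAME; valid for every `s ≤ 0`, `U ≥ 0`) or a kernel `5/8`-polarised band cap (`U`-independent, no claim node) — named per theorem with the
exact column margins; the generator asserts every inequality in exact rationals and the kernel re-checks by `nlinarith`. Cells in this file: `crH_1o2_Q_13o2to7_h1o20` [13 / 2,7].
WHAT THIS IS NOT: a certificate or number of record; CONTROL-class words conditional BY NAME (WS597 #634–#636, quarter-filling rows #674/#607/#606/#576, K2DIAG / registry nodes of the
column laws, the hubbard-thermal-eng-4 Markov claim nodes where a HOT anchor is named) and BY VALUE (B54/B67c/B85c 10-dp floors, EXT5 / XU `n`-sheets) exactly as printed in each signature;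
canonical / field / grand-canonical / layered equilibria as variational notions (existence not claimed); nothing at `t′ > 0` or `t′ < −3/10`; nothing about stripes as states,
ferromagnetism, superconductivity or `T_c`.

Seat hubbard-downfold-unc-2 g36 (`prover-hubbard-downfold-unc-2-g36-0`); generator `pub/hubbard-downfold/hubbard-downfold-unc-2/gen-g36/yb/gen36.py` (mode `axes0`, sentence `1o2`; exact `fractions`).
[cite: Israel1979, Thm. I.2.4] [cite: EmeryKivelsonLin1990, pp. 475–476] [cite: PoulinHastings2011, eqs. (3)–(8)] [cite: Griffiths1966, §II] [cite: Ruelle1969, §3.4] [cite: Israel1979, Thm. I.2.4] [cite: LiebPRL1989, proof of Theorem 1] [cite: PoulinHastings2011, eqs. (3)–(8)] [cite: Griffiths1964, §II] [cite: Israel1979, Thm. I.2.4] [cite: Griffiths1966, §II] [cite: PoulinHastings2011, eqs. (3)–(8)] [cite: Ruelle1969, §3.4] [cite: BratteliKishimotoRobinson1978, Thm. 2 (condition 2)] [cite: Lieb1973, §V (5.2)–(5.4)] [cite: LiebLoss1993, §8, Theorem 8.2] [cite: Griffiths1966, §II]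
-/

noncomputable section

namespace Summit.Ventures.CertifiedManyBodySolver.Observables

open Summit.Ventures.CertifiedManyBodySolver.Certificates Summit.Ventures.CertifiedManyBodySolver.Downfold
open Literature.MathematicalPhysics.QuantumLattice Literature.MathematicalPhysics.QuantumLattice.ThermodynamicLimit
open Literature.MathematicalPhysics.QuantumLattice.InfVolFermionState Set Filter

/-- **`(≤ 1/2 | ≥ 1)` IN THE FIELD, `T = 0`: segment Q `t′ ∈ [-1 / 4, -1 / 5] × U ∈ [13 / 2, 7]`, every `|h| ≤ 1/20·t`** (`≈ 380 T` at `t = 0.44 eV`;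
cap = the registry WITNESS-SPLIT plane of the CERTIFIED #597 state at filling `3/4` (rows #634–#636, claim node `cert_plaqseam_W4split597_TBD_allmk` BY NAME; `wsplit597_cap_tcap_on_cell`, hubbard-box-p3 g34: `e(1,s,U,3/4) ≤ −1.12227 − 0.30531·s + 0.02875·U`) at filling `3 / 4`, field cost `1/20·3 / 4 = 0.0375` against the column margins `U = 13 / 2`: M 0.0423∣0.0421; `U = 7`: M 0.0459∣0.0457; `n = 1` columns `es_n1_law13o2_d30` ∣ `es_n1_law7_d30` BY NAME):
no `(≤ 1/2 ∣ ≥ 1)` mixture of translation-invariant states is a ground state of `H(1,s,U) − h·(N↑ − N↓)` at its filling. [cite: Israel1979, Thm. I.2.4] [cite: Griffiths1964, Appendix] [cite: EmeryKivelsonLin1990, pp. 475–476] -/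
theorem crH_1o2_Q_13o2to7_h1o20 (h597 : cert_plaqseam_W4split597_TBD_allmk) (h649 : cert_r649_bs_GU6n1o2tpm3o10_w3_b4_R2_ob5p2_kry1_kry2c3rel_hanK7B4D4_KN4_PR20d4_hanK8c2s_uprime) (h606 : cert_r606_bs_GU8n1o2tpm3o10_w3_b4_R2_ob5p2_kry1_kry2c3rel_hanK7B4D4_KN4_PR20d4_hanK8c2s_uprime) (h570 : cert_r570_bs_GU4n1o2tp0_w3_b4_R2_ob5p2_kry1_kry2c3rel_hanK7B4D4_KN4_PR20d4_hanK8c2s_uprime) (h576 : cert_r576_bs_GU8n1o2tp0_w3_b4_R2_ob5p2_kry1_kry2c3rel_hanK7B4D4_KN4_PR20d4_hanK8c2s_uprime) (hB54 : ((-3505271351/5000000000 : ℚ) : ℝ) ≤ energyDensityTT' 1 (3 / 10) 6 1) (hB67c : ((-5566907601/10000000000 : ℚ) : ℝ) ≤ energyDensityTT' 1 (3 / 10) 8 1)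
    {s : ℝ} (hs : s ∈ Icc (-1 / 4 : ℝ) (-1 / 5)) {U : ℝ} (hU : U ∈ Icc (13 / 2 : ℝ) (7))
    {hz : ℝ} (hh : |hz| ≤ 1 / 20)
    {ω₁ ω₂ : InfVolFermionState 2} (h₁ : ω₁.IsTranslationInvariant) (h₂ : ω₂.IsTranslationInvariant)
    (hρ₁ : 0 < ω₁.density) (hρ₁' : ω₁.density ≤ 1 / 2) (hρ₂ : 1 ≤ ω₂.density) (hρ₂' : ω₂.density < 2)
    {lam : ℝ} (hl0 : 0 < lam) (hl1 : lam < 1) :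
    (gcInteractionTT' 1 s U 0 hz).tiGroundEnergyDensityAt 1 (mix lam hl0.le hl1.le ω₁ ω₂).density <
      (mix lam hl0.le hl1.le ω₁ ω₂).meanEnergy (gcInteractionTT' 1 s U 0 hz) 1 := by
  refine psH_not_fieldGroundState_mix_on_cell_of_columns_tcap 1 (s₁ := -1 / 4) (s₂ := -1 / 5) (U₁ := 13 / 2) (U₂ := 7)
    (n₁ := 1 / 2) (n₂ := 1) (a := 1 / 2) (b := 1 / 2) (c₀ := ((-2467887174335/2199023255552 : ℚ) : ℝ)) (cs := ((-1342778035095/4398046511104 : ℚ) : ℝ)) (c₁ := ((252892912483/8796093022208 : ℚ) : ℝ)) (h₀ := 1 / 20)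
    (by norm_num) (by norm_num) (by norm_num) (by norm_num) (by norm_num) (by norm_num) (by norm_num) (by norm_num)
    (wsplit597_cap_tcap_on_cell h597 (by norm_num) (by norm_num) (by norm_num))
    (fun s hs => es_n1_law13o2_d30 hB54 hB67c s ⟨hs.1.trans' (by norm_num), hs.2.trans (by norm_num)⟩)
    (fun s hs => es_n1_law7_d30 hB54 hB67c s ⟨hs.1.trans' (by norm_num), hs.2.trans (by norm_num)⟩)
    (fun s hs U hU => energyDensityTT'_anchor_le 1 s (n := 1 / 2) (by norm_num) (by norm_num) (U₀ := 13 / 2) (by norm_num) hU.1 (hw_half_floorLow68At h649 h606 h570 h576 (U₀ := 13 / 2) ⟨by norm_num, by norm_num⟩ s ⟨hs.1.trans' (by norm_num), hs.2.trans (by norm_num)⟩))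
    hh ?_ ?_ hs hU h₁ h₂ hρ₁ hρ₁' hρ₂ hρ₂' hl0 hl1
  · intro s hs; obtain ⟨h1, h2⟩ := hs; push_cast; norm_num; nlinarith [h1, h2]
  · intro s hs; obtain ⟨h1, h2⟩ := hs; push_cast; norm_num; nlinarith [h1, h2]

end Summit.Ventures.CertifiedManyBodySolver.Observables

end
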